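import Summits.HodgeConjecture.CorCM.IrreducibleOddWeightsCoreTowerCanonical
import Summits.HodgeConjecture.CorCM.IrreducibleOddWeightsCoreTowerQuadraticTrace
import HarnessLib

/-!
# Core tower, X: HODGE SIDE — mixed exceptional classes from a common subfield with a CM type; no mixed classes under
# the level-three criterion; the imaginary-quadratic-trace dichotomy for Hodge classes on `A₀^a × A₁^b`

COR-CM (cell `pub-hodgecm2`, binder seat `b16` gen 67, count-neutral claim CORE TOWER, file A10; theorems only, no
definition, no named fact, no `sorry`).  NEW as stated, hence under `Summits/`.  HONEST FRAMING: unconditional statements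
on which rational Hodge classes on products of two abelian varieties with complex multiplication are (not) combinations
of exterior products; the only classes claimed algebraic are those of the tree's nondegenerate-family theorem
(Pohlmann–Gordon); `HC_CM` is neither used nor asserted.

SETTING (A2–A4, A8).  CM fields `K_{i₀}, K_{i₁}`, types `Φ`, realisations `A_i ⊨ (K_i; Φ_i)`; `E₁`, `E₂` the Galois closures of
the trace fields `T₁ = b₀⁻¹(L₀) ≤ K_{i₁}`, `T₂ = a₀⁻¹(E₁) ≤ K_{i₀}` (A8).

* §1 `exists_cmType_not_hodgeClassesProductSpan_of_cmType_of_ringHom` — **a number field with a CM type embedded in BOTH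
  fields yields CM types `Φ` such that EVERY family of realisations carries a MIXED exceptional Hodge class** on some
  `A_{π₁}^• × A_{π₂}^•` with disjoint slot maps (A4 + the tree's product-span converse).
* §2 LEVEL THREE (canonical): `b(K_{i₁}) ∩ E₂ ⊂ ℝ` for every `b` ⟹ no mixed Hodge classes on any `A₀^a × A₁^b`, whatever the
  types; HC on all products for nondegenerate types (`forall_hodgeClassesProductSpan_pair_level_three`,
  `hodgeConjectureFor_prod_level_three`).
* §3 **THE IMAGINARY-QUADRATIC-TRACE DICHOTOMY** (`T₁` of degree `2` with an element outside `K_{i₁}⁺`):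
  if `T₁` embeds in `K_{i₀}` then some types carry mixed exceptional classes on every realisation
  (`exists_cmType_not_hodgeClassesProductSpan_of_ringHom_quadratic_trace`); if it does not, NO types do
  (`forall_hodgeClassesProductSpan_of_isEmpty_ringHom_quadratic_trace`).

## References

* [MoonenZarhin1999LowDim] B. Moonen, Yu. Zarhin, Math. Ann. 315 (1999), Thm. (0.2), §3 (3.1).
* [Gordon1999HodgeAVSurvey] B. B. Gordon, *A survey of the Hodge conjecture for abelian varieties*, 7.5–7.7, 7.6.1, 10.10.
* [Shimura1998] G. Shimura, *Abelian Varieties with Complex Multiplication and Modular Functions*, §18.2, §32.9.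
* [Lang2002] S. Lang, *Algebra*, 3rd ed., VI §1 Thm. 1.1, Thm. 1.12 and V §2 Thm. 2.8.
-/

set_option autoImplicit false

noncomputable section

open scoped BigOperators Classical
open CategoryTheory CategoryTheory.Limits NumberField Module IntermediateField

namespace Summit.HodgeConjecture.CorCM

open Literature.NumberTheory.ComplexMultiplication Literature.AlgebraicGeometry.Pohlmann1968
open Literature.AlgebraicGeometry.Motives (AbelianVariety CMType)
open Literature.AlgebraicGeometry.Motives.AbelianVariety
open Literature.AlgebraicGeometry.HodgeTheory
open Literature.AlgebraicGeometry.ComplexMultiplication (IsCMTypeRealisation)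

variable {I : Type} [Fintype I] [DecidableEq I] {K : I → Type} [∀ i, Field (K i)] [∀ i, NumberField (K i)]
  [∀ i, IsCMField (K i)]

/-! ### §1 A common subfield with a CM type yields mixed exceptional classes -/

omit [DecidableEq I] in
/-- **A NUMBER FIELD WITH A CM TYPE EMBEDDED IN BOTH `K_{i₀}` AND `K_{i₁}` YIELDS MIXED EXCEPTIONAL HODGE CLASSES**: there are
CM types `Φ` (the pair induced from `φ`) such that for EVERY family of realisations `A_i ⊨ (K_i; Φ_i)` some product
`A_{π₁}^• × A_{π₂}^•` with disjoint slot maps carries a rational Hodge class that is NOT a `ℂ`-combination of exterior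
products of Hodge classes of the factors. [cite: MoonenZarhin1999LowDim, §3 (3.1)] [cite: Gordon1999HodgeAVSurvey, 7.5–7.7 and 7.6.1] -/
theorem exists_cmType_not_hodgeClassesProductSpan_of_cmType_of_ringHom {i₀ i₁ : I} (h01 : i₀ ≠ i₁)
    (hI : ∀ l, l = i₀ ∨ l = i₁) {E : Type} [Field E] [NumberField E] (φ : CMType E) (e₀ : E →+* K i₀)
    (e₁ : E →+* K i₁) :
    ∃ Φ : ∀ i, CMType (K i), ∀ (A : I → AbelianVariety ℂ) (ιA : ∀ i, 𝓞 (K i) →+* End (A i))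
      (θ : ∀ i, K i →+* Module.End ℂ (complexBetti (A i).X 1)),
      (∀ i, IsCMTypeRealisation (Φ i) (A i) (ιA i) (θ i)) →
        ∃ (N₁ N₂ : ℕ) (_ : NeZero N₁) (_ : NeZero N₂) (π₁ : Fin N₁ → I) (π₂ : Fin N₂ → I),
          (∀ j₁ j₂, π₁ j₁ ≠ π₂ j₂) ∧ ¬ HodgeClassesProductSpan (⨁ fun j => A (π₁ j)) (⨁ fun j => A (π₂ j)) := by
  haveI : Nonempty I := ⟨i₀⟩
  obtain ⟨Φ, hlt⟩ := exists_cmFamilyRank_add_card_lt_of_cmType_of_ringHom h01 hI φ e₀ e₁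
  exact ⟨Φ, fun A ιA θ hA => exists_not_hodgeClassesProductSpan_of_cmFamilyRank_add_card_ne hA hlt.ne⟩

/-! ### §2 Level three: no mixed classes -/

variable {Φ : ∀ i, CMType (K i)} {A : I → AbelianVariety ℂ} {ιA : ∀ i, 𝓞 (K i) →+* End (A i)}
  {θ : ∀ i, K i →+* Module.End ℂ (complexBetti (A i).X 1)}

/-- **NO MIXED HODGE CLASSES under the level-three criterion**: if conjugation fixes `b(K_{i₁}) ∩ E₂` pointwise for every
`b` (`E₂` the Galois closure of the trace of `E₁` on `K_{i₀}`, `E₁` that of the trace of `L₀` on `K_{i₁}`), then every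
rational Hodge class on every `(⨁ A_{π₁}) × (⨁ A_{π₂})` with disjoint slot maps is a `ℂ`-combination of exterior products,
whatever the types. [cite: MoonenZarhin1999LowDim, §3 (3.1)] [cite: Gordon1999HodgeAVSurvey, 7.5–7.7] -/
theorem forall_hodgeClassesProductSpan_pair_level_three {i₀ i₁ : I} (h01 : i₀ ≠ i₁) (hI : ∀ l, l = i₀ ∨ l = i₁)
    (a₀ : K i₀ →+* ℂ) (b₀ : K i₁ →+* ℂ)
    (hreal : ∀ (b : K i₁ →+* ℂ) (k : K i₁),
      b k ∈ normalClosure ℚ ↥((normalClosure ℚ ↥((normalClosure ℚ (K i₀) ℂ).comap b₀.toRatAlgHom) ℂ).comap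
        a₀.toRatAlgHom) ℂ → starRingEnd ℂ (b k) = b k)
    (hA : ∀ i, IsCMTypeRealisation (Φ i) (A i) (ιA i) (θ i)) (N₁ N₂ : ℕ) [NeZero N₁] [NeZero N₂] (π₁ : Fin N₁ → I)
    (π₂ : Fin N₂ → I) (hdisj : ∀ l₁ l₂, π₁ l₁ ≠ π₂ l₂) :
    HodgeClassesProductSpan (⨁ fun l => A (π₁ l)) (⨁ fun l => A (π₂ l)) := by
  haveI : Nonempty I := ⟨i₀⟩
  exact (cmFamilyRank_add_card_eq_iff_forall_hodgeClassesProductSpan hA).1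
    (cmFamilyRank_add_card_eq_pair_of_forall_conj_apply_eq_level_three h01 hI Φ a₀ b₀ hreal) N₁ N₂ π₁ π₂ hdisj

omit [DecidableEq I] in
/-- **… and for NONDEGENERATE types every product `⨁_l A_{π l}` satisfies the Hodge conjecture, unconditionally.**
[cite: Gordon1999HodgeAVSurvey, 10.10 and 7.5] [cite: MoonenZarhin1999LowDim, Thm. (0.2)] -/
theorem hodgeConjectureFor_prod_level_three {i₀ i₁ : I} (h01 : i₀ ≠ i₁) (hI : ∀ l, l = i₀ ∨ l = i₁)
    (a₀ : K i₀ →+* ℂ) (b₀ : K i₁ →+* ℂ)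
    (hreal : ∀ (b : K i₁ →+* ℂ) (k : K i₁),
      b k ∈ normalClosure ℚ ↥((normalClosure ℚ ↥((normalClosure ℚ (K i₀) ℂ).comap b₀.toRatAlgHom) ℂ).comap
        a₀.toRatAlgHom) ℂ → starRingEnd ℂ (b k) = b k)
    (hnd : ∀ i, IsNondegenerate (Φ i)) (hA : ∀ i, IsCMTypeRealisation (Φ i) (A i) (ιA i) (θ i)) {N : ℕ}
    (π : Fin N → I) :
    HodgeConjectureFor (⨁ fun l : Fin N => A (π l)).dim (⨁ fun l : Fin N => A (π l)).X := by
  haveI : Nonempty I := ⟨i₀⟩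
  exact ((isNondegenerateFamily_iff_forall_of_forall_conj_apply_eq_level_three h01 hI Φ a₀ b₀ hreal).2
    hnd).hodgeConjectureFor_prod hA π

/-! ### §3 The imaginary-quadratic-trace dichotomy -/

omit [DecidableEq I] in
/-- **IMAGINARY QUADRATIC TRACE EMBEDDING IN `K_{i₀}` ⟹ MIXED EXCEPTIONAL CLASSES FOR SOME TYPES**: `T₁ = b₀⁻¹(L₀)` with an
element outside `K_{i₁}⁺` and a ring homomorphism `T₁ → K_{i₀}`: there are CM types for which every family of
realisations carries a mixed exceptional Hodge class. [cite: MoonenZarhin1999LowDim, §3 (3.1)]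
[cite: Gordon1999HodgeAVSurvey, 7.5–7.7 and 7.6.1] [cite: Shimura1998, §18.2] -/
theorem exists_cmType_not_hodgeClassesProductSpan_of_ringHom_quadratic_trace {i₀ i₁ : I} (h01 : i₀ ≠ i₁)
    (hI : ∀ l, l = i₀ ∨ l = i₁) (b₀ : K i₁ →+* ℂ) {k₁ : K i₁}
    (hk₁ : k₁ ∈ (normalClosure ℚ (K i₀) ℂ).comap b₀.toRatAlgHom) (hk₁' : k₁ ∉ maximalRealSubfield (K i₁))
    (e₀ : ↥((normalClosure ℚ (K i₀) ℂ).comap b₀.toRatAlgHom) →+* K i₀) :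
    ∃ Φ : ∀ i, CMType (K i), ∀ (A : I → AbelianVariety ℂ) (ιA : ∀ i, 𝓞 (K i) →+* End (A i))
      (θ : ∀ i, K i →+* Module.End ℂ (complexBetti (A i).X 1)),
      (∀ i, IsCMTypeRealisation (Φ i) (A i) (ιA i) (θ i)) →
        ∃ (N₁ N₂ : ℕ) (_ : NeZero N₁) (_ : NeZero N₂) (π₁ : Fin N₁ → I) (π₂ : Fin N₂ → I),
          (∀ j₁ j₂, π₁ j₁ ≠ π₂ j₂) ∧ ¬ HodgeClassesProductSpan (⨁ fun j => A (π₁ j)) (⨁ fun j => A (π₂ j)) := by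
  obtain ⟨φ⟩ := nonempty_cmType_of_forall_conjugate_ne (conjugate_ne_of_not_mem_maximalRealSubfield _ hk₁ hk₁')
  exact exists_cmType_not_hodgeClassesProductSpan_of_cmType_of_ringHom h01 hI φ e₀
    (algebraMap ↥((normalClosure ℚ (K i₀) ℂ).comap b₀.toRatAlgHom) (K i₁) : _ →+* K i₁)

/-- **IMAGINARY QUADRATIC TRACE NOT EMBEDDING IN `K_{i₀}` ⟹ NO MIXED CLASSES FOR ANY TYPES**: `[T₁ : ℚ] = 2` with an
element outside `K_{i₁}⁺` and NO ring homomorphism `T₁ → K_{i₀}`: for every pair of CM types and every family of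
realisations, every rational Hodge class on every `(⨁ A_{π₁}) × (⨁ A_{π₂})` with disjoint slot maps is a `ℂ`-combination
of exterior products. [cite: MoonenZarhin1999LowDim, §3 (3.1)] [cite: Gordon1999HodgeAVSurvey, 7.5–7.7]
[cite: Lang2002, VI §1 Thm. 1.12] -/
theorem forall_hodgeClassesProductSpan_of_isEmpty_ringHom_quadratic_trace {i₀ i₁ : I} (h01 : i₀ ≠ i₁)
    (hI : ∀ l, l = i₀ ∨ l = i₁) (b₀ : K i₁ →+* ℂ)
    (h2 : finrank ℚ ↥((normalClosure ℚ (K i₀) ℂ).comap b₀.toRatAlgHom) = 2) {k₁ : K i₁}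
    (hk₁ : k₁ ∈ (normalClosure ℚ (K i₀) ℂ).comap b₀.toRatAlgHom) (hk₁' : k₁ ∉ maximalRealSubfield (K i₁))
    (hempty : IsEmpty (↥((normalClosure ℚ (K i₀) ℂ).comap b₀.toRatAlgHom) →+* K i₀))
    (hA : ∀ i, IsCMTypeRealisation (Φ i) (A i) (ιA i) (θ i)) (N₁ N₂ : ℕ) [NeZero N₁] [NeZero N₂] (π₁ : Fin N₁ → I)
    (π₂ : Fin N₂ → I) (hdisj : ∀ l₁ l₂, π₁ l₁ ≠ π₂ l₂) :
    HodgeClassesProductSpan (⨁ fun l => A (π₁ l)) (⨁ fun l => A (π₂ l)) := by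
  haveI : Nonempty I := ⟨i₀⟩
  exact (cmFamilyRank_add_card_eq_iff_forall_hodgeClassesProductSpan hA).1
    ((forall_cmFamilyRank_add_card_eq_iff_isEmpty_ringHom_of_quadratic_trace h01 hI b₀ h2 hk₁ hk₁').2 hempty Φ)
    N₁ N₂ π₁ π₂ hdisj

omit [DecidableEq I] in
/-- **… and then, for NONDEGENERATE types, every product `⨁_l A_{π l}` satisfies the Hodge conjecture.**
[cite: Gordon1999HodgeAVSurvey, 10.10 and 7.5] [cite: MoonenZarhin1999LowDim, Thm. (0.2)] -/
theorem hodgeConjectureFor_prod_of_isEmpty_ringHom_quadratic_trace {i₀ i₁ : I} (h01 : i₀ ≠ i₁)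
    (hI : ∀ l, l = i₀ ∨ l = i₁) (b₀ : K i₁ →+* ℂ)
    (h2 : finrank ℚ ↥((normalClosure ℚ (K i₀) ℂ).comap b₀.toRatAlgHom) = 2) {k₁ : K i₁}
    (hk₁ : k₁ ∈ (normalClosure ℚ (K i₀) ℂ).comap b₀.toRatAlgHom) (hk₁' : k₁ ∉ maximalRealSubfield (K i₁))
    (hempty : IsEmpty (↥((normalClosure ℚ (K i₀) ℂ).comap b₀.toRatAlgHom) →+* K i₀))
    (hnd : ∀ i, IsNondegenerate (Φ i)) (hA : ∀ i, IsCMTypeRealisation (Φ i) (A i) (ιA i) (θ i)) {N : ℕ}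
    (π : Fin N → I) :
    HodgeConjectureFor (⨁ fun l : Fin N => A (π l)).dim (⨁ fun l : Fin N => A (π l)).X := by
  haveI : Nonempty I := ⟨i₀⟩
  exact ((isNondegenerateFamily_iff_forall_of_cmFamilyRank_add_card_eq Φ
    ((forall_cmFamilyRank_add_card_eq_iff_isEmpty_ringHom_of_quadratic_trace h01 hI b₀ h2 hk₁ hk₁').2 hempty Φ)).2
      hnd).hodgeConjectureFor_prod hA π

end Summit.HodgeConjecture.CorCM

end
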